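import Summits.BirchSwinnertonDyer.BirchSwinnertonDyer.Theorems.ThetaPartnerAtTwoSignedControlAtTwoPlusLogDescentTwo
import Summits.BirchSwinnertonDyer.BirchSwinnertonDyer.Theorems.ThetaPartnerAtTwoSignedControlAtTwoPlusTowerStepTwo
import HarnessLib

/-!
# The `ℤ₂`-LAYERS AT `2`, V: GLUE between the plus-field dictionary (`ℚ_[2]⟮u_m⟯`, parts I–IV) and the lead's plus-tower algebra
# (`ℚ_[2]⟮v_m⟯`, `v_m = u_m − 2`, files `…PlusTower{Two,IntegersTwo,LadderTwo,StepTwo}`): `ℚ₂(u_m) = ℚ₂(v_m)`, the tower input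
# `hdec` of the plus generation step DISCHARGED from the lead's TGEN, and the generation step with a general orbit generator `w`
# (K4 `SignedControlAtTwo`, stmt-BirchSwinnertonDyer-20309, line `eulerchar` v6, stub `stub_plusHondaSystemTwo`, clause (GEN))

Route `ThetaPartnerAtTwo` (TP2; crux shared with `ResidualThetaTransportAtTwo`), crux K4, line `eulerchar` v6 (lead
`prover-bsd-wall-tp2-p3` g2); seat `prover-bsd-wall-tp2-p3-w2` (width seat 2/3, g2).

WHY. Part IV's plus generation step `exists_sub_closure_sub_two_smul_mem_plus` (the (GEN) clause of `stub_plusHondaSystemTwo` at level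
`n` for points of the kernel of reduction) takes two analytic inputs: `hdec` (the tower lemma `(T_n)` in decomposition form
`𝒪_{k_n} ⊆ ℤ[Γ·v_n] + 8𝒪_{k_n} + k_{n−1}`) and `h811` («Prop. 8.11⁺ at 2»: `Λ(E₁(k_n)) ⊆ k_{n−1} + 𝒪_{k_n}`). The lead's file
`…PlusTowerStepTwo` proves TGEN `SignedEC.PlusTower.exists_mem_closure_pow_sigma_add` — `hdec` up to notation: fields `ℚ_[2]⟮v⟯` instead of
`ℚ_[2]⟮u⟯`, the orbit of `v` under the POWERS of `σ₃` instead of under `Γ_{ℚ₂}`, `2^a·x'` with `a = 3`. This file closes that gap, and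
restates the generation step for a GENERAL orbit generator `w` with `Λ g ≡ w (mod k_{n−1})` (the K3 lead's points `d_n = 3e_n − 2c_1` have
`Λ d_n ≡ 3v_n`, so `w = 3·v_n`; `hdec` for `c·v_n`, `c ∈ ℤ₂ˣ ∩ ℚ`, follows from `hdec` for `v_n`).

WHAT (THEOREMS ONLY; `u_m = zeta 2 m + (zeta 2 m)⁻¹`, `v_m = u_m − 2`, `κ` cyclotomic, `ι : ℚ̄ → ℚ̄₂` any, `M/ℤ₂` with `genFibΩ 2 M = W ⊗ ℚ̄₂`):
* §13 `adjoin_u_eq_adjoin_v` (`ℚ_[2]⟮u_m⟯ = ℚ_[2]⟮u_m − 2⟯`); `closure_range_pow_apply_le_closure_range_smul` (`ℤ⟨σ^i x⟩ ≤ ℤ[Γ·x]`);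
  `smul_closure_range_smul` (`c • ℤ[Γ·x] = ℤ[Γ·(c•x)]` for `c ∈ ℚ₂`).
* §14 **`plus_hdec`** — `hdec` at level `n ≥ 1` UNCONDITIONALLY (from the lead's TGEN with `σ₃` from `PlusTower.exists_sigma_three`):
  every `y ∈ ℚ₂(u_{n+2})`, `‖y‖ ≤ 1`, is `z + 8y' + ν`, `z ∈ ℤ[Γ·v_n]`, `y' ∈ 𝒪_{ℚ₂(u_{n+2})}`, `ν ∈ ℚ₂(u_{n+1})`; **`plus_hdec_smul`** — the same
  with `ℤ[Γ·(c•v_n)]` for any `c ∈ ℚ₂` with `‖c‖ = 1`.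
* §15 **`exists_sub_closure_sub_two_smul_mem_plus'`** — part IV's generation step with a general orbit generator `w` (hypotheses `hdec` for
  `w`, `h811`, `htors`, `Λ g − w ∈ k_{n−1}`); **`plusGen_kernel_of_h811`** — at level `n ≥ 1`, with `w = c•v_n` (`‖c‖ = 1`), ONLY `h811`
  and `htors` remain as hypotheses: the (GEN) clause of `stub_plusHondaSystemTwo` on `E₁(k_n)` ⟸ «Prop. 8.11⁺ at 2» + a generator `g` with
  `Λ g ≡ c·v_n (mod k_{n−1})` + no `2`-power torsion in `L(n+2)` (K3 `eq_zero_of_two_pow_smul_eq_zero_of_mem_subfieldPoints_layer`).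

HONEST FRAMING: THEOREMS ONLY (no definition, no named fact, no instance, no `sorry`), route-independent; `h811`, `htors` and the generator
are hypotheses; closes no item; BSD is not proved by any of this.

References: [Kobayashi2003] S. Kobayashi, Invent. Math. 152 (2003), §8.4 (Props. 8.11–8.12); [Washington1997] §13.1, Prop. 2.16.
-/

set_option autoImplicit false
-- the Theorems namespace of this sub repeats the summit name by design (D-0017 nested layout)
set_option linter.dupNamespace false

noncomputable section

open scoped Classical IntermediateField Topology NNReal

namespace Summit.BirchSwinnertonDyer.BirchSwinnertonDyer.Theorems.SignedEC.PlusLayer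

open Field WeierstrassCurve Literature.NumberTheory.EllipticCurves Literature.NumberTheory.GaloisRepresentations
  Literature.NumberTheory.EllipticCurves.ZpExtension Literature.NumberTheory.EllipticCurves.Kobayashi2003
  Literature.NumberTheory.EllipticCurves.FormalGroupChart
  Summit.BirchSwinnertonDyer.Rank1Residual.Additive Summit.BirchSwinnertonDyer.Rank1Residual.Additive.PadicCyclotomicTower
  Summit.BirchSwinnertonDyer.Rank1Residual.Additive.BallEval

/-! ## §13 `ℚ₂(u_m) = ℚ₂(v_m)`; orbits under powers of one automorphism vs. under `Γ_{ℚ₂}`; scaling an orbit -/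

section Notation

/-- **`ℚ_[2]⟮u_m⟯ = ℚ_[2]⟮u_m − 2⟯`** (`v_m = u_m − 2` is the lead's uniformizer; same field). [folklore] -/
theorem adjoin_u_eq_adjoin_v (m : ℕ) :
    ℚ_[2]⟮zeta 2 m + (zeta 2 m)⁻¹⟯ = ℚ_[2]⟮zeta 2 m + (zeta 2 m)⁻¹ - 2⟯ := by
  refine le_antisymm (IntermediateField.adjoin_simple_le_iff.mpr ?_) (IntermediateField.adjoin_simple_le_iff.mpr ?_)
  · have h := IntermediateField.mem_adjoin_simple_self ℚ_[2] (zeta 2 m + (zeta 2 m)⁻¹ - 2)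
    have h2 := add_mem h (by exact_mod_cast IntermediateField.natCast_mem ℚ_[2]⟮zeta 2 m + (zeta 2 m)⁻¹ - 2⟯ 2 :
      (2 : PadicAlgCl 2) ∈ ℚ_[2]⟮zeta 2 m + (zeta 2 m)⁻¹ - 2⟯)
    rwa [sub_add_cancel] at h2
  · exact v_mem_adjoin_u m

/-- The subgroup generated by the orbit of `x` under the POWERS of one automorphism `σ` lies in the subgroup generated by the
`Γ_{ℚ₂}`-orbit of `x`. [folklore] -/
theorem closure_range_pow_apply_le_closure_range_smul (σ : PadicAlgCl 2 ≃ₐ[ℚ_[2]] PadicAlgCl 2) (x : PadicAlgCl 2) :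
    AddSubgroup.closure (Set.range fun i : ℕ ↦ (σ ^ i) x) ≤
      AddSubgroup.closure (Set.range fun τ : absoluteGaloisGroup ℚ_[2] ↦ τ • x) := by
  refine AddSubgroup.closure_mono ?_
  rintro _ ⟨i, rfl⟩
  exact ⟨(absoluteGaloisGroup.toAlgEquiv ℚ_[2]).symm (σ ^ i), absoluteGaloisGroup.toAlgEquiv_symm_apply _ _⟩

/-- `τ • (c • x) = c • (τ • x)` for `c ∈ ℚ₂` (automorphisms are `ℚ₂`-linear). [folklore] -/
theorem galois_smul_smul (τ : absoluteGaloisGroup ℚ_[2]) (c : ℚ_[2]) (x : PadicAlgCl 2) : τ • (c • x) = c • (τ • x) := by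
  rw [absoluteGaloisGroup.smul_def, absoluteGaloisGroup.smul_def, Algebra.smul_def, Algebra.smul_def, map_mul,
    AlgEquiv.commutes]

/-- **Scaling an orbit**: `c • ℤ[Γ·x] = ℤ[Γ·(c • x)]` for `c ∈ ℚ₂` — precisely, `z ∈ ℤ[Γ·x] ⟹ c • z ∈ ℤ[Γ·(c•x)]`. [folklore] -/
theorem smul_mem_closure_range_smul (c : ℚ_[2]) (x : PadicAlgCl 2) {z : PadicAlgCl 2}
    (hz : z ∈ AddSubgroup.closure (Set.range fun τ : absoluteGaloisGroup ℚ_[2] ↦ τ • x)) :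
    c • z ∈ AddSubgroup.closure (Set.range fun τ : absoluteGaloisGroup ℚ_[2] ↦ τ • (c • x)) := by
  have h := AddSubgroup.mem_map_of_mem (DistribSMul.toAddMonoidHom (PadicAlgCl 2) c) hz
  rw [AddMonoidHom.map_closure] at h
  refine AddSubgroup.closure_mono ?_ h
  rintro _ ⟨_, ⟨τ, rfl⟩, rfl⟩
  refine ⟨τ, ?_⟩
  change τ • (c • x) = c • (τ • x)
  exact galois_smul_smul τ c x

end Notation

/-! ## §14 The tower input `hdec` of the plus generation step, DISCHARGED from the lead's TGEN -/

section Hdec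

/-- **`hdec` at level `n ≥ 1`, unconditionally**: every `y ∈ ℚ₂(u_{n+2})` with `‖y‖ ≤ 1` is `z + 8·y' + ν` with `z` in the subgroup
generated by the `Γ_{ℚ₂}`-orbit of `v_n = u_{n+2} − 2`, `y' ∈ ℚ₂(u_{n+2})` with `‖y'‖ ≤ 1`, and `ν ∈ ℚ₂(u_{n+1})` — the lead's TGEN
`SignedEC.PlusTower.exists_mem_closure_pow_sigma_add` (`M = n + 1 ≥ 2`, `a = 3`, `σ = σ₃` from `PlusTower.exists_sigma_three`) read in the
`ℚ_[2]⟮u⟯` / `Γ_{ℚ₂}`-orbit currency of part IV. [cite: Kobayashi2003, Props. 8.11–8.12] -/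
theorem plus_hdec {n : ℕ} (hn : 1 ≤ n) {y : PadicAlgCl 2} (hy : y ∈ ℚ_[2]⟮zeta 2 (n + 2) + (zeta 2 (n + 2))⁻¹⟯) (hy1 : ‖y‖ ≤ 1) :
    ∃ z ∈ AddSubgroup.closure (Set.range fun σ : absoluteGaloisGroup ℚ_[2] ↦ σ • (zeta 2 (n + 2) + (zeta 2 (n + 2))⁻¹ - 2)),
      ∃ y' ∈ ℚ_[2]⟮zeta 2 (n + 2) + (zeta 2 (n + 2))⁻¹⟯, ‖y'‖ ≤ 1 ∧
        y - z - 8 * y' ∈ ℚ_[2]⟮zeta 2 (n + 1) + (zeta 2 (n + 1))⁻¹⟯ := by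
  obtain ⟨σ, hσ⟩ := PlusTower.exists_sigma_three (m := n + 1 + 1) (by omega)
  have hy' : y ∈ ℚ_[2]⟮zeta 2 (n + 1 + 1) + (zeta 2 (n + 1 + 1))⁻¹ - 2⟯ := by
    rw [← adjoin_u_eq_adjoin_v]; exact hy
  obtain ⟨s, hs, y₀, ⟨hy₀, -⟩, x', ⟨hx', hx'1⟩, hdec⟩ :=
    PlusTower.exists_mem_closure_pow_sigma_add (M := n + 1) (by omega) hσ 3 hy' hy1
  refine ⟨s, closure_range_pow_apply_le_closure_range_smul σ _ hs, x', ?_, hx'1, ?_⟩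
  · rw [adjoin_u_eq_adjoin_v]; exact hx'
  · rw [adjoin_u_eq_adjoin_v]
    have e : y - s - 8 * x' = y₀ := by rw [hdec]; ring
    rw [e]; exact hy₀

/-- **`hdec` for a scaled orbit generator `c • v_n`, `c ∈ ℚ₂`, `‖c‖ = 1`** (e.g. `c = 3`: the K3 lead's normalisation `d_n = 3e_n − 2c_1` has
`Λ d_n ≡ 3·v_n`): from `plus_hdec` applied to `c⁻¹ • y`. [cite: Kobayashi2003, Props. 8.11–8.12] -/
theorem plus_hdec_smul {n : ℕ} (hn : 1 ≤ n) {c : ℚ_[2]} (hc : ‖c‖ = 1) {y : PadicAlgCl 2}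
    (hy : y ∈ ℚ_[2]⟮zeta 2 (n + 2) + (zeta 2 (n + 2))⁻¹⟯) (hy1 : ‖y‖ ≤ 1) :
    ∃ z ∈ AddSubgroup.closure (Set.range fun σ : absoluteGaloisGroup ℚ_[2] ↦ σ • (c • (zeta 2 (n + 2) + (zeta 2 (n + 2))⁻¹ - 2))),
      ∃ y' ∈ ℚ_[2]⟮zeta 2 (n + 2) + (zeta 2 (n + 2))⁻¹⟯, ‖y'‖ ≤ 1 ∧
        y - z - 8 * y' ∈ ℚ_[2]⟮zeta 2 (n + 1) + (zeta 2 (n + 1))⁻¹⟯ := by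
  have hc0 : c ≠ 0 := by rintro rfl; simp at hc
  have hcy : c⁻¹ • y ∈ ℚ_[2]⟮zeta 2 (n + 2) + (zeta 2 (n + 2))⁻¹⟯ := IntermediateField.smul_mem _ hy
  have hcy1 : ‖c⁻¹ • y‖ ≤ 1 := by
    rw [norm_smul, norm_inv, hc, inv_one, one_mul]; exact hy1
  obtain ⟨z, hz, y', hy', hy'1, hν⟩ := plus_hdec hn hcy hcy1
  refine ⟨c • z, smul_mem_closure_range_smul c _ hz, c • y', IntermediateField.smul_mem _ hy', ?_, ?_⟩
  · rw [norm_smul, hc, one_mul]; exact hy'1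
  · have e : c • (c⁻¹ • y - z - 8 * y') = y - c • z - 8 * (c • y') := by
      rw [smul_sub, smul_sub, smul_inv_smul₀ hc0, ← mul_smul_comm]
    rw [← e]
    exact IntermediateField.smul_mem _ hν

end Hdec

/-! ## §15 The generation step with a general orbit generator; the (GEN) clause on `E₁(k_n)` from «Prop. 8.11⁺ at 2» alone -/

section GenStep

variable {M : WeierstrassCurve ℤ_[2]} [hE : (M.map PadicInt.Coe.ringHom).IsElliptic]
  [hintΩ : (genFibΩ 2 M).IsIntegral (Valued.v (R := PadicAlgCl 2)).integer]
  {W : WeierstrassCurve ℚ} (hV : genFibΩ 2 M = W.baseChange (AlgebraicClosure ℚ_[2]))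
  {κ : ZpExtension ℚ 2} (ι : AlgebraicClosure ℚ →ₐ[ℚ] PadicAlgCl 2)

/-- **Part IV's plus generation step with a GENERAL orbit generator `w`** (`Λ g ≡ w (mod k_{n−1})`, `hdec` stated for `ℤ[Γ·w]`): every
`P ∈ L(n+2) ∩ E₁` with `toLoc P ∈ E(k_n)` is `B + P' + 2•R`, `B ∈ ℤ[Γ_{ℚ₂}]·toLoc g`, `P' ∈ E(k_{n−1})`, `R ∈ E(k_n)`. Same proof as
`exists_sub_closure_sub_two_smul_mem_plus` (which is the case `w = v_n`). [cite: Kobayashi2003, Prop. 8.11, Prop. 8.12] -/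
theorem exists_sub_closure_sub_two_smul_mem_plus' (hκ : κ.IsCyclotomic) {n : ℕ} {w : PadicAlgCl 2}
    (htors : ∀ Q ∈ subfieldPoints (genFibΩ 2 M) (layer 2 (n + 2)).toSubfield coeffs_mem_layer,
      ∀ k : ℕ, 2 ^ k • Q = 0 → Q = 0)
    (hdec : ∀ y ∈ ℚ_[2]⟮zeta 2 (n + 2) + (zeta 2 (n + 2))⁻¹⟯, ‖y‖ ≤ 1 →
      ∃ z ∈ AddSubgroup.closure (Set.range fun σ : absoluteGaloisGroup ℚ_[2] ↦ σ • w),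
        ∃ y' ∈ ℚ_[2]⟮zeta 2 (n + 2) + (zeta 2 (n + 2))⁻¹⟯, ‖y'‖ ≤ 1 ∧
          y - z - 8 * y' ∈ ℚ_[2]⟮zeta 2 (n + 1) + (zeta 2 (n + 1))⁻¹⟯)
    (h811 : ∀ P ∈ subfieldPoints (genFibΩ 2 M) (layer 2 (n + 2)).toSubfield coeffs_mem_layer,
      P ∈ kernel (Valued.v (R := PadicAlgCl 2)) (genFibΩ 2 M) → toLoc hV P ∈ localLayerPointsOfEmb κ ι W n →
        ∃ μ₀ ∈ ℚ_[2]⟮zeta 2 (n + 1) + (zeta 2 (n + 1))⁻¹⟯, ∃ y ∈ ℚ_[2]⟮zeta 2 (n + 2) + (zeta 2 (n + 2))⁻¹⟯,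
          ‖y‖ ≤ 1 ∧ ptLogΩ 2 M P = μ₀ + y)
    {g : (genFibΩ 2 M).toAffine.Point}
    (hgL : g ∈ subfieldPoints (genFibΩ 2 M) (layer 2 (n + 2)).toSubfield coeffs_mem_layer)
    (hgk : g ∈ kernel (Valued.v (R := PadicAlgCl 2)) (genFibΩ 2 M))
    (hgw : ptLogΩ 2 M g - w ∈ ℚ_[2]⟮zeta 2 (n + 1) + (zeta 2 (n + 1))⁻¹⟯)
    {P : (genFibΩ 2 M).toAffine.Point}
    (hPL : P ∈ subfieldPoints (genFibΩ 2 M) (layer 2 (n + 2)).toSubfield coeffs_mem_layer)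
    (hPk : P ∈ kernel (Valued.v (R := PadicAlgCl 2)) (genFibΩ 2 M)) (hPn : toLoc hV P ∈ localLayerPointsOfEmb κ ι W n) :
    ∃ B ∈ AddSubgroup.closure (Set.range fun σ : absoluteGaloisGroup ℚ_[2] ↦ σ • toLoc hV g),
      ∃ P' ∈ localLayerPointsOfEmb κ ι W (n - 1), ∃ R ∈ localLayerPointsOfEmb κ ι W n,
        toLoc hV P = B + P' + 2 • R := by
  haveI := isIntegral_curveK 2 (LayerField 2 (n + 2)) M
  set act : absoluteGaloisGroup ℚ_[2] → (genFibΩ 2 M).toAffine.Point → (genFibΩ 2 M).toAffine.Point :=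
    fun σ Q ↦ (toLoc hV).symm (σ • toLoc hV Q) with hact
  set L := subfieldPoints (genFibΩ 2 M) (layer 2 (n + 2)).toSubfield coeffs_mem_layer with hLdef
  set E₁ := kernel (Valued.v (R := PadicAlgCl 2)) (genFibΩ 2 M) with hE₁def
  set Fn := ℚ_[2]⟮zeta 2 (n + 2) + (zeta 2 (n + 2))⁻¹⟯ with hFn
  set Fn' := ℚ_[2]⟮zeta 2 (n + 1) + (zeta 2 (n + 1))⁻¹⟯ with hFn'
  obtain ⟨μ₀, hμ₀, y, hy, hy1, hΛP⟩ := h811 P hPL hPk hPn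
  obtain ⟨z, hz, y', hy', hy'1, hν⟩ := hdec y hy hy1
  have h4 : ‖(4 : PadicAlgCl 2) * y'‖ ≤ 1 / 4 := by
    have h2n : ‖(2 : PadicAlgCl 2)‖ = 2⁻¹ := by
      have h := (PadicAlgCl.norm_extends (p := 2) ((2 : ℕ) : ℚ_[2])).trans Padic.norm_p
      rw [map_natCast] at h
      exact_mod_cast h
    have h4n : ‖(4 : PadicAlgCl 2)‖ = 4⁻¹ := by
      rw [show (4 : PadicAlgCl 2) = 2 ^ 2 by norm_num, norm_pow, h2n]; norm_num
    rw [norm_mul, h4n]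
    calc (4 : ℝ)⁻¹ * ‖y'‖ ≤ 4⁻¹ * 1 := by gcongr
      _ = 1 / 4 := by norm_num
  obtain ⟨R, hRL, hRk, hRy, hRn⟩ := exists_ptLogΩ_eq_of_mem_adjoin_u hV ι hκ htors
    (Subalgebra.mul_mem _ (by exact_mod_cast IntermediateField.natCast_mem Fn 4) hy') h4
  obtain ⟨B, hB, hBL, hBk, hBz⟩ := exists_closure_pt_of_sub_mem act (act_zero hV) (act_some hV) Fn'
    (fun σ x hx ↦ by rw [absoluteGaloisGroup.smul_def]; exact apply_mem_adjoin_u _ hx) hgL hgk hgw hz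
  have h2RL : (2 : ℕ) • R ∈ L := L.nsmul_mem hRL 2
  have h2Rk : (2 : ℕ) • R ∈ E₁ := E₁.nsmul_mem hRk 2
  have hDL : P - B - (2 : ℕ) • R ∈ L := L.sub_mem (L.sub_mem hPL hBL) h2RL
  have hDk : P - B - (2 : ℕ) • R ∈ E₁ := E₁.sub_mem (E₁.sub_mem hPk hBk) h2Rk
  have hΛ2R : ptLogΩ 2 M ((2 : ℕ) • R) = 8 * y' := by
    rw [ptLogΩ_nsmul hRL hRk, hRy]; push_cast; ring
  have hΛD : ptLogΩ 2 M (P - B - (2 : ℕ) • R) ∈ Fn' := by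
    rw [ptLogΩ_sub (m := n + 2) (L.sub_mem hPL hBL) h2RL (E₁.sub_mem hPk hBk) h2Rk,
      ptLogΩ_sub (m := n + 2) hPL hBL hPk hBk, hΛP, hΛ2R]
    have e : μ₀ + y - ptLogΩ 2 M B - 8 * y' = μ₀ + (y - z - 8 * y') - (ptLogΩ 2 M B - z) := by ring
    rw [e]
    exact IntermediateField.sub_mem _ (IntermediateField.add_mem _ hμ₀ hν) hBz
  have hdesc : toLoc hV (P - B - (2 : ℕ) • R) ∈ localLayerPointsOfEmb κ ι W (n - 1) := by
    rcases Nat.eq_zero_or_pos n with rfl | hn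
    · have hΛ0 : ptLogΩ 2 M (P - B - (2 : ℕ) • R) ∈ ℚ_[2]⟮zeta 2 (0 + 2) + (zeta 2 (0 + 2))⁻¹⟯ := by
        have hbot : Fn' ≤ ℚ_[2]⟮zeta 2 (0 + 2) + (zeta 2 (0 + 2))⁻¹⟯ := by
          rw [hFn', show (0 + 1 : ℕ) = 1 from rfl, adjoin_u_one_eq_bot]; exact bot_le
        exact hbot hΛD
      simpa using toLoc_mem_localLayerPointsOfEmb_of_ptLogΩ_mem hV ι hκ htors hDL hDk hΛ0
    · obtain ⟨n', rfl⟩ := Nat.exists_eq_add_of_le' hn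
      rw [Nat.add_sub_cancel]
      exact toLoc_mem_localLayerPointsOfEmb_of_ptLogΩ_mem hV ι hκ htors hDL hDk (by simpa [hFn'] using hΛD)
  refine ⟨toLoc hV B, ?_, toLoc hV (P - B - (2 : ℕ) • R), hdesc, toLoc hV R, hRn, ?_⟩
  · rw [← map_closure_range_act_eq hV g]
    exact ⟨B, hB, rfl⟩
  · simp only [map_sub, map_nsmul]
    abel

/-- **The (GEN) clause of `stub_plusHondaSystemTwo` on `E₁(k_n)` from «Prop. 8.11⁺ at 2» alone** (`n ≥ 1`): the tower input is
DISCHARGED (`plus_hdec_smul`, from the lead's TGEN); what remains as hypotheses is `h811` (the lead's Prop. 8.11⁺ read in `Ω`), the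
no-`2`-power-torsion fact `htors` for `L(n+2)` (K3 lead's Prop. 8.7 at `2`), and a generator `g ∈ L(n+2) ∩ E₁` with `Λ g ≡ c·v_n (mod k_{n−1})`
for some `c ∈ ℚ₂`, `‖c‖ = 1` (K3 lead's `d_n`, `c = 3`). [cite: Kobayashi2003, Prop. 8.11, Prop. 8.12] -/
theorem plusGen_kernel_of_h811 (hκ : κ.IsCyclotomic) {n : ℕ} (hn : 1 ≤ n) {c : ℚ_[2]} (hc : ‖c‖ = 1)
    (htors : ∀ Q ∈ subfieldPoints (genFibΩ 2 M) (layer 2 (n + 2)).toSubfield coeffs_mem_layer,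
      ∀ k : ℕ, 2 ^ k • Q = 0 → Q = 0)
    (h811 : ∀ P ∈ subfieldPoints (genFibΩ 2 M) (layer 2 (n + 2)).toSubfield coeffs_mem_layer,
      P ∈ kernel (Valued.v (R := PadicAlgCl 2)) (genFibΩ 2 M) → toLoc hV P ∈ localLayerPointsOfEmb κ ι W n →
        ∃ μ₀ ∈ ℚ_[2]⟮zeta 2 (n + 1) + (zeta 2 (n + 1))⁻¹⟯, ∃ y ∈ ℚ_[2]⟮zeta 2 (n + 2) + (zeta 2 (n + 2))⁻¹⟯,
          ‖y‖ ≤ 1 ∧ ptLogΩ 2 M P = μ₀ + y)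
    {g : (genFibΩ 2 M).toAffine.Point}
    (hgL : g ∈ subfieldPoints (genFibΩ 2 M) (layer 2 (n + 2)).toSubfield coeffs_mem_layer)
    (hgk : g ∈ kernel (Valued.v (R := PadicAlgCl 2)) (genFibΩ 2 M))
    (hgw : ptLogΩ 2 M g - c • (zeta 2 (n + 2) + (zeta 2 (n + 2))⁻¹ - 2) ∈ ℚ_[2]⟮zeta 2 (n + 1) + (zeta 2 (n + 1))⁻¹⟯)
    {P : (genFibΩ 2 M).toAffine.Point}
    (hPL : P ∈ subfieldPoints (genFibΩ 2 M) (layer 2 (n + 2)).toSubfield coeffs_mem_layer)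
    (hPk : P ∈ kernel (Valued.v (R := PadicAlgCl 2)) (genFibΩ 2 M)) (hPn : toLoc hV P ∈ localLayerPointsOfEmb κ ι W n) :
    ∃ B ∈ AddSubgroup.closure (Set.range fun σ : absoluteGaloisGroup ℚ_[2] ↦ σ • toLoc hV g),
      ∃ P' ∈ localLayerPointsOfEmb κ ι W (n - 1), ∃ R ∈ localLayerPointsOfEmb κ ι W n,
        toLoc hV P = B + P' + 2 • R :=
  exists_sub_closure_sub_two_smul_mem_plus' hV ι hκ htors (fun _ hy hy1 ↦ plus_hdec_smul hn hc hy hy1) h811 hgL hgk hgw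
    hPL hPk hPn

end GenStep

end Summit.BirchSwinnertonDyer.BirchSwinnertonDyer.Theorems.SignedEC.PlusLayer

end
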